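import Summits.BirchSwinnertonDyer.BirchSwinnertonDyer.Theorems.Rank1ResidualX9Defs
import Literature.NumberTheory.EllipticCurves.Rank1Residual.MuLambdaCarriers
import Literature.NumberTheory.IwasawaTheory.ClassicalMuInvariant
import Literature.NumberTheory.EllipticCurves.DivisionField
import Literature.NumberTheory.EllipticCurves.GaloisAction
import HarnessLib
import HarnessLib.Audit

/-!
# «The classical Iwasawa `μ` of ONE torsion-point field controls `μ(Sel)` on class X9» — the cell's
# descent-lens candidates DESC-C1′ / DESC-C1, filed as OPEN obligation nodes (`@[conjecture] def`)

HONEST FRAMING (cell `bsd-f3-mu`, D-0131 (3) FRONTIER TIER, HOME `run/shared/lean/pub/bsd-f3-mu/`;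
charter: «by what mechanism is `μ(L_p(E)) = 0 = μ(Sel)` when `ρ̄_{E,p}` is irreducible but not
surjective, and can Greenberg–Vatsal congruence transfer be made image-free?»).  TYPER's filing of the
descent / visibility lens's two refuter-cleared statements (2026-08-27): a pure CONJECTURE LEAF — only
`@[conjecture] def`s, no theorem, nothing about any curve asserted, typed ≠ proved ≠ endorsed.  Kernel
edges (Greenberg-X9 ⟹ these; items 19629 ∧ 19630 ⟹ these; DESC-C1′ + per-pair certificates + 19630 ⟹
`IntegralMainConjectureOnClassX9`) live in the sibling `TorsionPointFieldMuEdges.lean`.  These nodes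
concern the SELMER-side `μ` (the charter's second `μ`) by a mechanism disjoint from modular symbols and
from Kato's Euler system (class groups + units of `ℚ(E[p])`); they do NOT feed the `-imc` squeeze
(`KatoDivisibilityEdges.lean`), which wants the divisibility node `KatoDivisibilityOnClassX9`.

## Provenance (cell record; every sentence has a file of record in HOME)

* MEMO-desc.md §3 + ADDENDUM (planner `-desc`, 2026-08-27T13:46Z/13:52Z; `HOME/desc/Sketch.lean` sha16
  a5880f55c733b101, rc 0): **DESC-C1′ `TorsionPointFieldMuSufficesOnClassX9`** (candidate of record)
  and **DESC-C1 `ClassicalMuSufficesOnClassX9`**.  Dictionary behind them (MEMO-desc §2, «T-D», paper):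
  on X9 the image is TAME (`p ∤ #ρ̄(Γ_ℚ)`, tree lemma
  `Rank1Residual.not_dvd_card_range_galoisRepTorsion_of_irreducible_of_not_surjective`), so
  `μ^alg(E,p) = 0 ⟺` (K1: the `ρ̄`-isotypic `μ` of the unramified Iwasawa module of `L_∞ = ℚ(E[p])_∞`
  vanishes) ∧ (K2: the `ρ̄`-isotypic `Λ`-adic unit, projected to the ordinary eigenline at `p`, has
  Coleman series prime to `p`).  The classical `μ_p(L) = 0` gives K1; for `H = Stab(P)`, `p ∤ #H`,
  restriction embeds `X_nr(L_∞)^H ↪ X_nr(ℚ(P)_∞)` and `ρ̄^H ∋ P ≠ 0`, so already `μ_p(ℚ(P)) = 0` gives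
  K1 (`[ℚ(P):ℚ]` = 8 / 12 / 24 on X9, 4 / 8 on X10b).  The CONTENT of both nodes is «⟹ K2».
* REF1-AUDIT.md §3.1.desc (+ addendum) (refuter `-ref1`, 13:52Z/14:05Z; scratch HOME/ref1/DescAudit.lean,
  Desc2Probe.lean rc 0): DESC-C1 **SURVIVES** (rc 0, simp/aesop fail, BC7 CLEAN, hypotheses satisfiable;
  STRUCTURE: hypothesis-decorated weakening of «`μ^alg = 0` on X9» — kernel one-liner — hence implied by
  Greenberg-X9 and by 19630 ∧ 19629, NOT data-refutable; value = PROVABILITY target); DESC-C1′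
  **SURVIVES** (rc 0, BC7 CLEAN; stronger than DESC-C1 by transfer, `p ∤ [L:ℚ(P)]`; hypothesis
  Fukuda-certifiable) — desc candidate of record.  DESC-C1ᵃⁿ REDUNDANT (⟸ 19630), DESC-C2ʳ NOT RECOMMENDED
  as typed (decorative hypotheses) — neither is filed.
* REF2-LITMAP.md §3 (refuter `-ref2`, 13:54Z/13:55Z): DESC-C1 **OPEN, NOT IN PRINT**: it is Ray 2023
  Thm 2 [arXiv:2308.06673 p. 4 L6–14: irreducible ∧ «Conjecture (5.3) holds» ∧ `μ_p(L) = 0` ⟹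
  `μ(Sel) = 0`] with Conjecture 5.3 [p. 13] DELETED; the deleted content = «`μ_p(L) = 0 ⟹ K2`», for which
  print offers neither support nor heuristic (GV-Artin I Rem. 5.5 [arXiv:1806.05659 p. 25] «for the
  non-dihedral type, absolutely nothing is known»).  DESC-C1′ **OPEN, NOT IN PRINT**, same residual content
  on base `ℚ(P)`; DRS23 [arXiv:2202.09937 p. 10 L54] «explicit computation with class groups of fields
  generated by torsion points of elliptic curves is difficult, we do not provide an example» — the cell's
  `(d3)/(d6)` columns would be the first such examples.
* BC5 witness (MEMO-desc §4): on the 789/789 certified rows of the census of record (`μ_an = 0` ⟹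
  `μ_alg = 0` by 19629 mod F1) the CONCLUSION holds, so no row can disagree; the nodes are NOT killable by
  the `μ`-table alone.  Cheapest falsifier of DESC-C1′: ONE pair with a Fukuda-certified `ℚ(P)`
  (`IwasawaTheory.classicalMuVanishes_of_classGroupPRank_succ_eq`: `rank_p Cl(ℚ(P)) = rank_p Cl(ℚ(P)·ℚ₁)`)
  and `μ_an ≥ 1` — impossible on the census (0/790 rows with `μ_an ≥ 1`); column `(d6)` requested from
  `-data` (13:52Z).
* Why novel (planner's sentence, MEMO-desc §5): «Ray's theorem needs `μ_p` of the whole degree-≤ 96 field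
  and an unnamed inertia conjecture; the tame dictionary replaces both by the `ρ̄`-isotypic class group
  and one unit of `ℚ(E[p])`» — honest grade: conditional Selmer-side reduction node, no new mechanism
  for K2.

## The statements (verbatim the audited Sketch texts; tree vocabulary only)

* `TorsionPointFieldMuSufficesOnClassX9` — for every X9 pair `(W, p)`: if some nonzero
  `P ∈ E[p](ℚ̄)` (`geomTorsion W p`) has `ClassicalMuVanishes κ` (Iwasawa's `μ = 0` in GROWTH FORM,
  `IwasawaTheory/ClassicalMuInvariant.lean`) for every cyclotomic `ℤ_p`-extension `κ` of the fixed field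
  of `Stab_{Γ_ℚ}(P)` (= `ℚ(P)`), then `MuAlgZeroAt W p` (`μ(X(E/ℚ_∞)) = 0` for all cyclotomic data;
  carrier of `MuLambdaCarriers.lean`).
* `ClassicalMuSufficesOnClassX9` — the same with the hypothesis at the full division field
  `W.divisionField p = ℚ(E[p])` (`DivisionField.lean`).  (DESC-C1′ ⟹ DESC-C1 needs `μ = 0` to descend
  from `ℚ(E[p])` to `ℚ(P)` — a number-field lemma not in the tree; not claimed here.)

References: [Ray2023] = arXiv:2308.06673 Thm. 2 (p. 4), Conj. 5.3, Thm. 5.4 (p. 13);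
[GreenbergVatsalArtinI] = arXiv:1806.05659 Hyp. A (p. 2), Rem. 5.5 (p. 25); [KarnatakiRay2023] =
arXiv:2309.03738 Thm. 3.9; [DRS2023] = arXiv:2202.09937 p. 10; [GreenbergLNM1716] Conj. 1.11; HOME
MEMO-desc.md, REF1-AUDIT.md §3.1.desc, REF2-LITMAP.md §3, CANDIDATES.md §1 rows 3/3a.
-/

-- the summit and its single problem are both named `BirchSwinnertonDyer` (registry layout D-0017):
-- the X9 class predicate lives in `Summit.BirchSwinnertonDyer.BirchSwinnertonDyer.Rank1Residual`
set_option linter.dupNamespace false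

noncomputable section

open scoped Classical

open WeierstrassCurve Literature.NumberTheory.EllipticCurves Literature.NumberTheory.IwasawaTheory
  Summit.BirchSwinnertonDyer.BirchSwinnertonDyer.Rank1Residual
open Literature.NumberTheory.EllipticCurves.Rank1Residual (MuAlgZeroAt)

namespace Summit.BirchSwinnertonDyer.Rank1Residual.SmallImageMu

/-- **DESC-C1′ — the classical `μ` of ONE torsion-point field suffices on class X9 (OPEN; desc candidate
of record, refuter-cleared 2026-08-27; nothing asserted).**  For every X9 pair `(E, p)` (`ClassX9 W p`:
no CM, `p ≥ 5` good ordinary, `E[p]` irreducible and NOT surjective): if there is a nonzero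
`P ∈ E[p](ℚ̄)` such that every cyclotomic `ℤ_p`-extension `κ` of `ℚ(P)` (the fixed field of the
stabiliser of `P` in `Γ_ℚ`) has Iwasawa `μ = 0` in growth form (`ClassicalMuVanishes κ`:
`ord_p h(ℚ(P)_n) = λ n + ν` for `n ≫ 0`), then `μ(X(E/ℚ_∞)) = 0` for all cyclotomic data
(`MuAlgZeroAt W p`).  The hypothesis is CERTIFIABLE per pair in-tree by Fukuda's criterion
(`classicalMuVanishes_of_classGroupPRank_succ_eq`); `[ℚ(P):ℚ]` = 8 / 12 / 24 on X9 for an eigenline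
point.  Content beyond print = Ray's Conjecture 5.3 (the inertia / unit piece K2) on the locus
`μ_p(ℚ(P)) = 0`; Ray 2023 Thm 2 proves «irreducible ∧ Conj 5.3 ∧ `μ_p(ℚ(E[p])) = 0` ⟹ `μ(Sel) = 0`».
Implied by Greenberg's Conj. 1.11 on X9 (edges file).  Verbatim the audited `HOME/desc/Sketch.lean` text.
[cite: Ray2023, Thm. 2 (p. 4) and Conj. 5.3 / Thm. 5.4 (p. 13) of arXiv:2308.06673 — the conditional printed form; OPEN as stated]
[cite: GreenbergLNM1716, §1 Conj. 1.11 (p. 64) — implies it] -/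
@[conjecture] def TorsionPointFieldMuSufficesOnClassX9 : Prop :=
  ∀ (W : WeierstrassCurve ℚ) [W.IsElliptic] [W.IsGloballyMinimal] (p : ℕ) [Fact p.Prime],
    ClassX9 W p →
    (∃ P : geomTorsion W (p : ℤ), P ≠ 0 ∧
      ∀ κ : ZpExtension
          (IntermediateField.fixedField (MulAction.stabilizer (Field.absoluteGaloisGroup ℚ) P)) p,
        κ.IsCyclotomic → ClassicalMuVanishes κ) →
    MuAlgZeroAt W p

/-- **DESC-C1 — the classical `μ` of the division field suffices on class X9 (OPEN; weaker companion of
DESC-C1′, refuter-cleared 2026-08-27; nothing asserted).**  For every X9 pair `(E, p)`: if every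
cyclotomic `ℤ_p`-extension `κ` of `ℚ(E[p])` (`W.divisionField p`) has Iwasawa `μ = 0` in growth form,
then `MuAlgZeroAt W p`.  = Ray 2023 Thm 2 with his Conjecture 5.3 DELETED (ref2); a hypothesis-decorated
weakening of «`μ^alg = 0` on X9» (ref1), hence implied by Greenberg-X9 and by items 19629 ∧ 19630
(edges file); NOT data-refutable (degree-≤ 96 field); value = provability target.
[cite: Ray2023, Thm. 2 (p. 4) of arXiv:2308.06673 — printed WITH Conj. 5.3 as hypothesis; OPEN without it]
[cite: GreenbergLNM1716, §1 Conj. 1.11 (p. 64) — implies it] -/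
@[conjecture] def ClassicalMuSufficesOnClassX9 : Prop :=
  ∀ (W : WeierstrassCurve ℚ) [W.IsElliptic] [W.IsGloballyMinimal] (p : ℕ) [Fact p.Prime],
    ClassX9 W p →
    (∀ κ : ZpExtension (W.divisionField p) p, κ.IsCyclotomic → ClassicalMuVanishes κ) →
    MuAlgZeroAt W p

end Summit.BirchSwinnertonDyer.Rank1Residual.SmallImageMu

end
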